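import Literature.NumberTheory.ComplexMultiplication.CMTypeGaloisClassReflexDegree
import Literature.FieldTheory.AlgClosed.AutFixedSubfield
import HarnessLib

/-!
# The reflex field of the unitary Shimura datum `(F, Φ, φ₀ ∈ Φ)` of Rapoport–Smithling–Zhang:
# `Aut(ℂ/E) = Stab(Φ) ∩ Stab(φ₀)`, `E = E_Φ · φ₀(F)`, «`F ⊂ E` via `φ₀`, possibly proper when `F/ℚ` is not Galois»

Layer `Literature/NumberTheory/ComplexMultiplication`, namespace `Literature.NumberTheory.ComplexMultiplication` (lane
`lit-hodgefound`, Track 2 foundations, Layer A3; seat `lit-hodgefound-p11`, generation 28, row g28-#1).  THEOREMS ONLY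
(D-0026): no definition, no named fact, no instance.

THE PRINT.  M. Rapoport, B. Smithling, W. Zhang, *Arithmetic diagonal cycles on unitary Shimura varieties*, Compositio
Math. 156 (2020) [RapoportSmithlingZhang2017] (arXiv:1710.06962v3, page-located on the arXiv PDF).  §3 p. 9: «we take
`F` to be a CM field over `ℚ` […] and we denote by `Φ` the induced CM type for `F`»; §3.1 p. 9: «for a distinguished
element `φ₀ ∈ Φ`, the signature of `W_{φ₀}` is `(1, n−1)`, and for all other `φ ∈ Φ` the signature of `W_φ` is
`(0, n)`»; §3.1 p. 9, eq. (3.1): «It is easy to see that `(H̃, {h_H̃})`, `(G̃, {h_G̃})`, and `(H̃G, {h_H̃G})` have common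
reflex field `E ⊂ ℂ` characterized by `Aut(ℂ/E) = {σ ∈ Aut(ℂ) ∣ σΦ = Φ and σφ₀ = φ₀}`.  (3.1)  Note `F` is a subfield
of `E` via `φ₀` (possibly proper when `F/ℚ` is not Galois).»; Remark 3.1 (i) p. 9: «The reflex field of
`(Z^ℚ, {h_{Z^ℚ}})` is the reflex field `E_Φ` of the CM type `Φ`, i.e. the fixed field of the group
`{σ ∈ Aut(ℂ) ∣ σΦ = Φ}`.  Manifestly, `E_Φ ⊂ E`.»; Introduction p. 2: «We fix a CM type `Φ` of `F` and a
distinguished element `φ₀ ∈ Φ`.  Let `n ≥ 2` and let `r : Hom(F, ℂ) → {0, 1, n−1, n}`, `φ ↦ r_φ`, be the function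
defined by `r_φ := 1`, `φ = φ₀`; `0`, `φ ∈ Φ ∖ {φ₀}`; `n − r_φ̄`, `φ ∉ Φ`.  Associated to these data, there is the field
`E ⊂ ℚ̄` which is the composite of the reflex field of `r` and the reflex field of `Φ`.  Then `E` contains `F` via
`φ₀`.»  G. Shimura, *Abelian Varieties with Complex Multiplication and Modular Functions* (1998) [Shimura1998] §8.3
Prop. 28: `K* = ℚ(tr_Φ)` and «`γS = S` iff `γ` fixes `K*`» (the tree's
`forall_smul_mem_iff_iff_forall_apply_traceField_eq`).  S. Lang, *Algebra* (2002) [Lang2002] Ch. VIII §1 (extension of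
automorphisms to `ℂ`; the tree's `Complex.mem_subfield_of_forall_ringEquiv`: the fixed field of `Aut(ℂ/M)` is `M` for a
countable subfield `M ⊂ ℂ`).

THE MODEL (the complex model of `CMTypeHarrisTaylorSignatureReflexField`, g27-#4): `F` a number field, `Φ : CMType F`
a complex CM type, `φ₀ : F →+* ℂ`; `Aut(ℂ) = ℂ ≃+* ℂ` acts on `Hom(F, ℂ)` by composition (scoped `ringEquivCompAction`,
`(τ • φ) x = τ (φ x)`); «`τΦ = Φ`» is `∀ χ, τ • χ ∈ Φ.1 ↔ χ ∈ Φ.1`, «`τφ₀ = φ₀`» is `τ • φ₀ = φ₀`, «`τ` fixes `M`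
pointwise» (`τ ∈ Aut(ℂ/M)`) is `∀ z ∈ M, τ z = z`; `E_Φ = traceField Φ = ℚ(tr_Φ(F)) ⊂ ℂ` (`ComplexReflexField`), `φ₀(F)`
is `φ₀.toRatAlgHom.fieldRange`, and RSZ's `E` is WRITTEN OUT as the compositum
`traceField Φ ⊔ φ₀.toRatAlgHom.fieldRange : IntermediateField ℚ ℂ` (no definition is introduced).

WHAT IS PROVED.

§1 Galois correspondence in `ℂ` for `K*` (CM-type form of the tree's Orientation / `E`-Hodge-structure analogues
   `Motives/HodgeStructureOfOrientationReflexTraceField.traceField_le_iff_forall`,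
   `Motives/HodgeStructureCMActionReflexField.reflexField_le_iff_forall` — same method, not imported):
   `traceField_le_iff_forall_smul_mem_iff` (`K* ≤ M ⟺ Aut(ℂ/M) ≤ Stab Φ`, `M ⊂ ℂ` countable), **`mem_traceField_iff_forall_smul_mem_iff`**
   (Remark 3.1 (i): `K*` IS the fixed field of `{τ ∣ τΦ = Φ}`), `forall_mem_fieldRange_iff_smul_eq` (`Aut(ℂ/φ₀(F)) = Stab φ₀`),
   `forall_mem_sup_iff` (pointwise fixing of a compositum).
§2 eq. (3.1): **`forall_mem_traceField_sup_fieldRange_iff`** (`τ` fixes `E` pointwise `⟺ τΦ = Φ ∧ τφ₀ = φ₀`),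
   **`mem_traceField_sup_fieldRange_iff_forall`** (`E` is the fixed field of `Stab Φ ∩ Stab φ₀`),
   **`eq_traceField_sup_fieldRange_iff_forall`** («characterized by»: a number field `M ⊂ ℂ` with `Aut(ℂ/M) = Stab Φ ∩ Stab φ₀`
   IS `E`), `traceField_le_traceField_sup_fieldRange` («Manifestly `E_Φ ⊂ E`»), `apply_mem_traceField_sup_fieldRange`
   («`F ⊂ E` via `φ₀`»), finiteness and degrees (`[φ₀F : ℚ] ∣ [E : ℚ]`, `[K* : ℚ] ∣ [E : ℚ]`, `[E : ℚ] ≤ [K* : ℚ]·[F : ℚ]`),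
   `traceField_sup_fieldRange_le_fieldRange` (`E ≤ ι(L)` for every Galois `L ⊂ ℂ` through which `φ₀` factors) and
   `finrank_traceField_sup_fieldRange_dvd` (`[E : ℚ] ∣ [L : ℚ]`).
§3 the Introduction's `r` (its three printed clauses as hypotheses on `r : Hom(F, ℂ) → ℕ`, no definition):
   `apply_add_apply_conjugate_eq` (`r_φ + r_φ̄ = n`), **`smul_eq_of_forall_apply_smul_eq_of_forall_smul_mem_iff`** and
   **`apply_smul_eq_of_forall_smul_mem_iff_of_smul_eq`** (`Stab r ∩ Stab Φ = Stab Φ ∩ Stab φ₀`: «`E` is the composite of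
   the reflex field of `r` and the reflex field of `Φ`»), and for `n ≥ 3` (`Φ = {r ≤ 1}`, `{φ₀} = {r = 1}`)
   **`forall_apply_smul_eq_iff`** (`Stab r = Stab Φ ∩ Stab φ₀`: `E = E_r` already); field level
   `mem_traceField_sup_fieldRange_iff_forall_apply_smul_eq`.
§4 «possibly proper when `F/ℚ` is not Galois»: `traceField_sup_fieldRange_eq_fieldRange_iff` (`E = φ₀(F) ⟺ K* ≤ φ₀(F)`),
   `traceField_sup_fieldRange_eq_fieldRange_iff_forall` (`⟺ Stab φ₀ ≤ Stab Φ`),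
   **`traceField_sup_fieldRange_eq_fieldRange_of_isGalois`** (`F/ℚ` Galois ⟹ `E = φ₀(F)` for every `Φ`, `φ₀`),
   `traceField_sup_fieldRange_ne_fieldRange_of_not_dvd` / `_of_finrank_lt` (`[K* : ℚ] ∤ [F : ℚ]`, e.g. `[K* : ℚ] > [F : ℚ]`
   as in Dodson's case `[K* : ℚ] = 2^g`, `g ≥ 3` — the tree's `finrank_traceField_eq_two_pow_of_finrank_normalClosure_eq` —
   `⟹ E ≠ φ₀(F)`).

## References

* [RapoportSmithlingZhang2017] M. Rapoport, B. Smithling, W. Zhang, *Arithmetic diagonal cycles on unitary Shimura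
  varieties*, Compositio Math. 156 (2020) 1745–1824; arXiv:1710.06962v3: Introduction p. 2, §3.1 p. 9 eq. (3.1),
  Remark 3.1 (i).
* [Shimura1998] G. Shimura, *Abelian Varieties with Complex Multiplication and Modular Functions* (1998), §8.3 Prop. 28.
* [Lang2002] S. Lang, *Algebra*, 3rd ed. (2002), Ch. VIII §1 (automorphisms of `ℂ`), Ch. V §2.
* [MilneFT2022] J. S. Milne, *Fields and Galois Theory* (2022), Cor. 3.10, Prop. 2.7, Prop. 3.18 (compositum degree).
* [Dodson1984] B. Dodson, *The structure of Galois groups of CM-fields*, Trans. AMS 283 (1984), §1.3.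

## Provenance

Lane `lit-hodgefound` (HOME `run/shared/lean/pub/lit-hodgefound/`), prover seat `lit-hodgefound-p11` (gen 28),
self-proposed row g28-#1 (lane INBOX claim 2026-08-27T19:33:08Z), successor pointer (t4) of the gen-27 closing line;
sequel of `CMTypeHarrisTaylorSignatureReflexField` (g27-#4: the Harris–Taylor / RSZ signature and its reflex field).
-/

set_option autoImplicit false

noncomputable section

open scoped Cardinal
open NumberField Module IntermediateField

namespace Literature.NumberTheory.ComplexMultiplication

open Literature.AlgebraicGeometry.Motives (CMType)
open Literature.FieldTheory.AlgClosed (Complex.mem_subfield_of_forall_ringEquiv)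

variable {F : Type} [Field F]

/-! ## §0 Preliminaries -/

section Prelim

variable [NumberField F]

/-- The points of `ℂ` fixed by one automorphism `τ` form a subfield (bookkeeping: an `IntermediateField ℚ ℂ`).
[cite: MilneFT2022, Ch. 3 («fixed field» `E^H`)] -/
private theorem exists_intermediateField_mem_iff_apply_eq (τ : ℂ ≃+* ℂ) :
    ∃ D : IntermediateField ℚ ℂ, ∀ z : ℂ, z ∈ D ↔ τ z = z := by
  have hq : ∀ q : ℚ, τ (algebraMap ℚ ℂ q) = algebraMap ℚ ℂ q := fun q => by
    rw [eq_ratCast]; exact map_ratCast τ q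
  let f : ℂ →ₐ[ℚ] ℂ := (AlgEquiv.ofRingEquiv (f := τ) hq).toAlgHom
  exact ⟨⟨AlgHom.equalizer f (AlgHom.id ℚ ℂ), fun y (hy : τ y = y) => show τ y⁻¹ = y⁻¹ by rw [map_inv₀, hy]⟩,
    fun _ => Iff.rfl⟩

/-- A number field inside `ℂ` is countable (bookkeeping for the `Aut(ℂ)` fixed-field theorem). [folklore] -/
private theorem cardinalMk_toSubfield_le_aleph0_de (M : IntermediateField ℚ ℂ) [FiniteDimensional ℚ M] :
    #M.toSubfield ≤ ℵ₀ := by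
  rw [Cardinal.mk_le_aleph0_iff]
  exact Countable.of_equiv _ (Module.finBasis ℚ M).equivFun.toEquiv.symm

/-- `K* = ℚ(tr_Φ(F))` is a finite extension of `ℚ`. [folklore] -/
private theorem finiteDimensional_traceField_de (Φ : CMType F) : FiniteDimensional ℚ (traceField Φ) :=
  Module.finite_of_finrank_pos (finrank_traceField_pos Φ)

/-- The image of an embedding of a number field is finite over `ℚ`. [folklore] -/
private theorem finiteDimensional_fieldRange_de (s : F →+* ℂ) : FiniteDimensional ℚ s.toRatAlgHom.fieldRange :=
  LinearEquiv.finiteDimensional (AlgEquiv.ofInjectiveField s.toRatAlgHom).toLinearEquiv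

/-- `[s(F) : ℚ] = [F : ℚ]`. [folklore] -/
private theorem finrank_fieldRange_de (s : F →+* ℂ) : finrank ℚ s.toRatAlgHom.fieldRange = finrank ℚ F := by
  rw [← IntermediateField.finrank_eq_finrank_subalgebra, AlgHom.fieldRange_toSubalgebra]
  exact (AlgEquiv.ofInjectiveField s.toRatAlgHom).toLinearEquiv.finrank_eq.symm

/-- `E = K* · φ₀(F)` is finite over `ℚ`. [folklore] -/
private theorem finiteDimensional_sup_de (Φ : CMType F) (φ₀ : F →+* ℂ) :
    FiniteDimensional ℚ (traceField Φ ⊔ φ₀.toRatAlgHom.fieldRange : IntermediateField ℚ ℂ) := by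
  haveI := finiteDimensional_traceField_de Φ
  haveI := finiteDimensional_fieldRange_de φ₀
  exact IntermediateField.finiteDimensional_sup _ _

/-- `A ≤ B` inside `ℂ`, `B` a number field `⟹ [A : ℚ] ∣ [B : ℚ]` (tower law). [cite: MilneFT2022, Prop. 1.20 (multiplicativity of degrees)] -/
private theorem finrank_dvd_of_le_de {A B : IntermediateField ℚ ℂ} (h : A ≤ B) : finrank ℚ A ∣ finrank ℚ B :=
  Dvd.intro _ (IntermediateField.finrank_bot_mul_relfinrank h)

/-- `A ≤ B` inside `ℂ`, `B` a number field `⟹ [A : ℚ] ≤ [B : ℚ]`. [cite: MilneFT2022, Prop. 1.20] -/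
private theorem finrank_le_of_le_de {A B : IntermediateField ℚ ℂ} [FiniteDimensional ℚ B] (h : A ≤ B) :
    finrank ℚ A ≤ finrank ℚ B :=
  Nat.le_of_dvd Module.finrank_pos (finrank_dvd_of_le_de h)

end Prelim

/-! ## §1 The Galois correspondence in `ℂ` for `K*`, for `φ₀(F)` and for composita -/

section GaloisInC

variable [NumberField F]

/-- **Pointwise fixing of a compositum**: `τ` fixes `M · N` pointwise iff it fixes `M` and `N` pointwise (the points fixed by
`τ` form a subfield). [cite: MilneFT2022, Ch. 3 (fixed fields) and Cor. 3.10] -/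
theorem forall_mem_sup_iff (τ : ℂ ≃+* ℂ) (M N : IntermediateField ℚ ℂ) :
    (∀ z : ℂ, z ∈ M ⊔ N → τ z = z) ↔ (∀ z : ℂ, z ∈ M → τ z = z) ∧ ∀ z : ℂ, z ∈ N → τ z = z := by
  constructor
  · exact fun h => ⟨fun z hz => h z ((le_sup_left : M ≤ M ⊔ N) hz), fun z hz => h z ((le_sup_right : N ≤ M ⊔ N) hz)⟩
  · rintro ⟨hM, hN⟩
    obtain ⟨D, hD⟩ := exists_intermediateField_mem_iff_apply_eq τ
    have hle : M ⊔ N ≤ D := sup_le (fun z hz => (hD z).2 (hM z hz)) (fun z hz => (hD z).2 (hN z hz))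
    exact fun z hz => (hD z).1 (hle hz)

/-- **`Aut(ℂ/φ₀(F)) = Stab(φ₀)`**: `τ` fixes the subfield `φ₀(F) ⊂ ℂ` pointwise iff `τ ∘ φ₀ = φ₀`.
[cite: RapoportSmithlingZhang2017, §3.1 eq. (3.1) («`σφ₀ = φ₀`»)] -/
theorem forall_mem_fieldRange_iff_smul_eq (τ : ℂ ≃+* ℂ) (φ₀ : F →+* ℂ) :
    (∀ z : ℂ, z ∈ φ₀.toRatAlgHom.fieldRange → τ z = z) ↔ τ • φ₀ = φ₀ := by
  constructor
  · intro h
    exact RingHom.ext fun x => by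
      rw [ringEquiv_smul_apply]
      exact h _ (AlgHom.mem_fieldRange.2 ⟨x, rfl⟩)
  · intro h z hz
    obtain ⟨x, rfl⟩ := AlgHom.mem_fieldRange.1 hz
    change τ (φ₀ x) = φ₀ x
    rw [← ringEquiv_smul_apply τ φ₀ x, h]

/-- **Galois correspondence in `ℂ` for the reflex field**: for a COUNTABLE subfield `M ⊂ ℂ`, `K* = ℚ(tr_Φ) ⊆ M` iff every
automorphism of `ℂ` fixing `M` pointwise stabilises `Φ` (`⟹` Shimura's Prop. 28; `⟸` the fixed field of `Aut(ℂ/M)` is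
`M`). [cite: Shimura1998, §8.3 Prop. 28] [cite: Lang2002, Ch. VIII §1] -/
theorem traceField_le_iff_forall_smul_mem_iff (Φ : CMType F) (M : IntermediateField ℚ ℂ) (hM : #M.toSubfield ≤ ℵ₀) :
    traceField Φ ≤ M ↔
      ∀ τ : ℂ ≃+* ℂ, (∀ z : ℂ, z ∈ M → τ z = z) → ∀ χ : F →+* ℂ, τ • χ ∈ Φ.1 ↔ χ ∈ Φ.1 := by
  constructor
  · intro hle τ hτ
    exact forall_smul_mem_iff_of_forall_apply_traceField_eq τ Φ fun z hz => hτ z (hle hz)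
  · intro h z hz
    exact Complex.mem_subfield_of_forall_ringEquiv M.toSubfield hM fun τ hτ =>
      forall_apply_eq_of_forall_smul_mem_iff τ Φ (h τ fun w hw => hτ w hw) z hz

/-- The same for a NUMBER FIELD `M ⊂ ℂ`. [cite: Shimura1998, §8.3 Prop. 28] [cite: Lang2002, Ch. VIII §1] -/
theorem traceField_le_iff_forall_smul_mem_iff_of_finiteDimensional (Φ : CMType F) (M : IntermediateField ℚ ℂ)
    [FiniteDimensional ℚ M] :
    traceField Φ ≤ M ↔
      ∀ τ : ℂ ≃+* ℂ, (∀ z : ℂ, z ∈ M → τ z = z) → ∀ χ : F →+* ℂ, τ • χ ∈ Φ.1 ↔ χ ∈ Φ.1 :=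
  traceField_le_iff_forall_smul_mem_iff Φ M (cardinalMk_toSubfield_le_aleph0_de M)

/-- **Remark 3.1 (i): `E_Φ` IS «the fixed field of the group `{σ ∈ Aut(ℂ) ∣ σΦ = Φ}`»** — a complex number lies in
`K* = ℚ(tr_Φ)` iff it is fixed by every `τ` with `τΦ = Φ`. [cite: RapoportSmithlingZhang2017, §3.1 Remark 3.1 (i)]
[cite: Shimura1998, §8.3 Prop. 28] [cite: Lang2002, Ch. VIII §1] -/
theorem mem_traceField_iff_forall_smul_mem_iff (Φ : CMType F) (z : ℂ) :
    z ∈ traceField Φ ↔ ∀ τ : ℂ ≃+* ℂ, (∀ χ : F →+* ℂ, τ • χ ∈ Φ.1 ↔ χ ∈ Φ.1) → τ z = z := by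
  constructor
  · intro hz τ hτ
    exact forall_apply_eq_of_forall_smul_mem_iff τ Φ hτ z hz
  · intro h
    haveI := finiteDimensional_traceField_de Φ
    exact Complex.mem_subfield_of_forall_ringEquiv (traceField Φ).toSubfield
      (cardinalMk_toSubfield_le_aleph0_de (traceField Φ)) fun τ hτ =>
        h τ (forall_smul_mem_iff_of_forall_apply_traceField_eq τ Φ hτ)

end GaloisInC

/-! ## §2 Eq. (3.1): `Aut(ℂ/E) = {σ ∣ σΦ = Φ and σφ₀ = φ₀}` for `E = E_Φ · φ₀(F)` -/

section ReflexField

variable [NumberField F] (Φ : CMType F) (φ₀ : F →+* ℂ)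

/-- **RSZ eq. (3.1): `Aut(ℂ/E) = {σ ∈ Aut(ℂ) ∣ σΦ = Φ and σφ₀ = φ₀}` for `E = E_Φ · φ₀(F)`** — `τ` fixes the compositum
of the reflex field `K* = ℚ(tr_Φ)` and `φ₀(F)` pointwise iff `τΦ = Φ` and `τφ₀ = φ₀`.
[cite: RapoportSmithlingZhang2017, §3.1 eq. (3.1)] [cite: Shimura1998, §8.3 Prop. 28] -/
theorem forall_mem_traceField_sup_fieldRange_iff (τ : ℂ ≃+* ℂ) :
    (∀ z : ℂ, z ∈ traceField Φ ⊔ φ₀.toRatAlgHom.fieldRange → τ z = z) ↔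
      (∀ χ : F →+* ℂ, τ • χ ∈ Φ.1 ↔ χ ∈ Φ.1) ∧ τ • φ₀ = φ₀ := by
  rw [forall_mem_sup_iff, ← forall_smul_mem_iff_iff_forall_apply_traceField_eq, forall_mem_fieldRange_iff_smul_eq]

/-- `Aut(ℂ/E) ≤ Stab(Φ)`. [cite: RapoportSmithlingZhang2017, §3.1 eq. (3.1)] -/
theorem forall_smul_mem_iff_of_forall_mem_traceField_sup_fieldRange {τ : ℂ ≃+* ℂ}
    (h : ∀ z : ℂ, z ∈ traceField Φ ⊔ φ₀.toRatAlgHom.fieldRange → τ z = z) (χ : F →+* ℂ) :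
    τ • χ ∈ Φ.1 ↔ χ ∈ Φ.1 :=
  ((forall_mem_traceField_sup_fieldRange_iff Φ φ₀ τ).1 h).1 χ

/-- `Aut(ℂ/E) ≤ Stab(φ₀)`. [cite: RapoportSmithlingZhang2017, §3.1 eq. (3.1)] -/
theorem smul_eq_of_forall_mem_traceField_sup_fieldRange {τ : ℂ ≃+* ℂ}
    (h : ∀ z : ℂ, z ∈ traceField Φ ⊔ φ₀.toRatAlgHom.fieldRange → τ z = z) : τ • φ₀ = φ₀ :=
  ((forall_mem_traceField_sup_fieldRange_iff Φ φ₀ τ).1 h).2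

/-- `Stab(Φ) ∩ Stab(φ₀) ≤ Aut(ℂ/E)`. [cite: RapoportSmithlingZhang2017, §3.1 eq. (3.1)] -/
theorem forall_mem_traceField_sup_fieldRange_of_forall_smul_mem_iff_of_smul_eq {τ : ℂ ≃+* ℂ}
    (hΦ : ∀ χ : F →+* ℂ, τ • χ ∈ Φ.1 ↔ χ ∈ Φ.1) (hφ₀ : τ • φ₀ = φ₀) :
    ∀ z : ℂ, z ∈ traceField Φ ⊔ φ₀.toRatAlgHom.fieldRange → τ z = z :=
  (forall_mem_traceField_sup_fieldRange_iff Φ φ₀ τ).2 ⟨hΦ, hφ₀⟩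

/-- **`E = E_Φ · φ₀(F)` is a number field** (finite over `ℚ`). [cite: RapoportSmithlingZhang2017, §3.1 eq. (3.1)]
[cite: MilneFT2022, Prop. 3.18 (degree of a compositum)] -/
theorem finiteDimensional_traceField_sup_fieldRange :
    FiniteDimensional ℚ (traceField Φ ⊔ φ₀.toRatAlgHom.fieldRange : IntermediateField ℚ ℂ) :=
  finiteDimensional_sup_de Φ φ₀

/-- **`E` IS THE FIXED FIELD OF `Stab(Φ) ∩ Stab(φ₀)`**: `z ∈ E` iff `z` is fixed by every `τ ∈ Aut(ℂ)` with `τΦ = Φ` and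
`τφ₀ = φ₀` (eq. (3.1) read as a description of `E`; `⟸` because the fixed field of `Aut(ℂ/E)` is `E`).
[cite: RapoportSmithlingZhang2017, §3.1 eq. (3.1)] [cite: Lang2002, Ch. VIII §1] -/
theorem mem_traceField_sup_fieldRange_iff_forall (z : ℂ) :
    z ∈ traceField Φ ⊔ φ₀.toRatAlgHom.fieldRange ↔
      ∀ τ : ℂ ≃+* ℂ, (∀ χ : F →+* ℂ, τ • χ ∈ Φ.1 ↔ χ ∈ Φ.1) → τ • φ₀ = φ₀ → τ z = z := by
  constructor
  · intro hz τ hΦ hφ₀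
    exact forall_mem_traceField_sup_fieldRange_of_forall_smul_mem_iff_of_smul_eq Φ φ₀ hΦ hφ₀ z hz
  · intro h
    haveI := finiteDimensional_sup_de Φ φ₀
    exact Complex.mem_subfield_of_forall_ringEquiv (traceField Φ ⊔ φ₀.toRatAlgHom.fieldRange).toSubfield
      (cardinalMk_toSubfield_le_aleph0_de _) fun τ hτ =>
        h τ (forall_smul_mem_iff_of_forall_mem_traceField_sup_fieldRange Φ φ₀ hτ)
          (smul_eq_of_forall_mem_traceField_sup_fieldRange Φ φ₀ hτ)

/-- **`E ⊆ M ⟺ Aut(ℂ/M) ⊆ Stab(Φ) ∩ Stab(φ₀)`** for a countable subfield `M ⊂ ℂ`.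
[cite: RapoportSmithlingZhang2017, §3.1 eq. (3.1)] [cite: Lang2002, Ch. VIII §1] -/
theorem traceField_sup_fieldRange_le_iff_forall (M : IntermediateField ℚ ℂ) (hM : #M.toSubfield ≤ ℵ₀) :
    traceField Φ ⊔ φ₀.toRatAlgHom.fieldRange ≤ M ↔
      ∀ τ : ℂ ≃+* ℂ, (∀ z : ℂ, z ∈ M → τ z = z) → (∀ χ : F →+* ℂ, τ • χ ∈ Φ.1 ↔ χ ∈ Φ.1) ∧ τ • φ₀ = φ₀ := by
  constructor
  · intro hle τ hτ
    exact (forall_mem_traceField_sup_fieldRange_iff Φ φ₀ τ).1 fun z hz => hτ z (hle hz)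
  · intro h z hz
    exact Complex.mem_subfield_of_forall_ringEquiv M.toSubfield hM fun τ hτ =>
      (mem_traceField_sup_fieldRange_iff_forall Φ φ₀ z).1 hz τ (h τ fun w hw => hτ w hw).1
        (h τ fun w hw => hτ w hw).2

/-- The same for a number field `M ⊂ ℂ`. [cite: RapoportSmithlingZhang2017, §3.1 eq. (3.1)] -/
theorem traceField_sup_fieldRange_le_iff_forall_of_finiteDimensional (M : IntermediateField ℚ ℂ)
    [FiniteDimensional ℚ M] :
    traceField Φ ⊔ φ₀.toRatAlgHom.fieldRange ≤ M ↔
      ∀ τ : ℂ ≃+* ℂ, (∀ z : ℂ, z ∈ M → τ z = z) → (∀ χ : F →+* ℂ, τ • χ ∈ Φ.1 ↔ χ ∈ Φ.1) ∧ τ • φ₀ = φ₀ :=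
  traceField_sup_fieldRange_le_iff_forall Φ φ₀ M (cardinalMk_toSubfield_le_aleph0_de M)

/-- **«characterized by» (3.1): `E` is THE subfield of `ℂ` with `Aut(ℂ/E) = Stab(Φ) ∩ Stab(φ₀)`** — a countable
subfield `M ⊂ ℂ` whose pointwise stabiliser in `Aut(ℂ)` is `{τ ∣ τΦ = Φ ∧ τφ₀ = φ₀}` equals `E_Φ · φ₀(F)`.
[cite: RapoportSmithlingZhang2017, §3.1 eq. (3.1)] [cite: Lang2002, Ch. VIII §1] -/
theorem eq_traceField_sup_fieldRange_of_forall_iff (M : IntermediateField ℚ ℂ) (hM : #M.toSubfield ≤ ℵ₀)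
    (h : ∀ τ : ℂ ≃+* ℂ, (∀ z : ℂ, z ∈ M → τ z = z) ↔ (∀ χ : F →+* ℂ, τ • χ ∈ Φ.1 ↔ χ ∈ Φ.1) ∧ τ • φ₀ = φ₀) :
    M = traceField Φ ⊔ φ₀.toRatAlgHom.fieldRange := by
  refine le_antisymm (fun z hz => ?_) ((traceField_sup_fieldRange_le_iff_forall Φ φ₀ M hM).2 fun τ => (h τ).1)
  exact (mem_traceField_sup_fieldRange_iff_forall Φ φ₀ z).2 fun τ hΦ hφ₀ => (h τ).2 ⟨hΦ, hφ₀⟩ z hz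

/-- **Eq. (3.1) as a characterisation among number fields `M ⊂ ℂ`**: `M = E_Φ · φ₀(F)` iff
`Aut(ℂ/M) = Stab(Φ) ∩ Stab(φ₀)`. [cite: RapoportSmithlingZhang2017, §3.1 eq. (3.1)] [cite: Lang2002, Ch. VIII §1] -/
theorem eq_traceField_sup_fieldRange_iff_forall (M : IntermediateField ℚ ℂ) [FiniteDimensional ℚ M] :
    M = traceField Φ ⊔ φ₀.toRatAlgHom.fieldRange ↔
      ∀ τ : ℂ ≃+* ℂ, (∀ z : ℂ, z ∈ M → τ z = z) ↔ (∀ χ : F →+* ℂ, τ • χ ∈ Φ.1 ↔ χ ∈ Φ.1) ∧ τ • φ₀ = φ₀ := by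
  constructor
  · rintro rfl τ
    exact forall_mem_traceField_sup_fieldRange_iff Φ φ₀ τ
  · exact eq_traceField_sup_fieldRange_of_forall_iff Φ φ₀ M (cardinalMk_toSubfield_le_aleph0_de M)

/-- **Remark 3.1 (i): «Manifestly, `E_Φ ⊂ E`.»** [cite: RapoportSmithlingZhang2017, §3.1 Remark 3.1 (i)] -/
theorem traceField_le_traceField_sup_fieldRange :
    traceField Φ ≤ traceField Φ ⊔ φ₀.toRatAlgHom.fieldRange :=
  le_sup_left

/-- **«`F` is a subfield of `E` via `φ₀`»**: `φ₀(F) ⊆ E`. [cite: RapoportSmithlingZhang2017, §3.1 (after eq. (3.1))]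
[cite: RapoportSmithlingZhang2017, Introduction p. 2 («`E` contains `F` via `φ₀`»)] -/
theorem fieldRange_le_traceField_sup_fieldRange :
    φ₀.toRatAlgHom.fieldRange ≤ traceField Φ ⊔ φ₀.toRatAlgHom.fieldRange :=
  le_sup_right

/-- `φ₀(x) ∈ E` for every `x ∈ F`. [cite: RapoportSmithlingZhang2017, §3.1 (after eq. (3.1))] -/
theorem apply_mem_traceField_sup_fieldRange (x : F) : φ₀ x ∈ traceField Φ ⊔ φ₀.toRatAlgHom.fieldRange :=
  fieldRange_le_traceField_sup_fieldRange Φ φ₀ (AlgHom.mem_fieldRange.2 ⟨x, rfl⟩)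

/-- `tr_Φ(x) ∈ E` for every `x ∈ F`. [cite: RapoportSmithlingZhang2017, §3.1 Remark 3.1 (i)] -/
theorem cmTypeTrace_mem_traceField_sup_fieldRange (x : F) :
    cmTypeTrace Φ x ∈ traceField Φ ⊔ φ₀.toRatAlgHom.fieldRange :=
  traceField_le_traceField_sup_fieldRange Φ φ₀ (cmTypeTrace_mem_traceField Φ x)

/-- **`[F : ℚ] ∣ [E : ℚ]`** (`F ≅ φ₀(F) ⊆ E`). [cite: RapoportSmithlingZhang2017, §3.1 (after eq. (3.1))]
[cite: MilneFT2022, Prop. 1.20] -/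
theorem finrank_dvd_finrank_traceField_sup_fieldRange :
    finrank ℚ F ∣ finrank ℚ (traceField Φ ⊔ φ₀.toRatAlgHom.fieldRange : IntermediateField ℚ ℂ) := by
  rw [← finrank_fieldRange_de φ₀]
  exact finrank_dvd_of_le_de (fieldRange_le_traceField_sup_fieldRange Φ φ₀)

/-- `[F : ℚ] ≤ [E : ℚ]`. [cite: RapoportSmithlingZhang2017, §3.1 (after eq. (3.1))] -/
theorem finrank_le_finrank_traceField_sup_fieldRange :
    finrank ℚ F ≤ finrank ℚ (traceField Φ ⊔ φ₀.toRatAlgHom.fieldRange : IntermediateField ℚ ℂ) := by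
  haveI := finiteDimensional_sup_de Φ φ₀
  rw [← finrank_fieldRange_de φ₀]
  exact finrank_le_of_le_de (fieldRange_le_traceField_sup_fieldRange Φ φ₀)

/-- **`[E_Φ : ℚ] ∣ [E : ℚ]`** (`E_Φ ⊆ E`). [cite: RapoportSmithlingZhang2017, §3.1 Remark 3.1 (i)] [cite: MilneFT2022, Prop. 1.20] -/
theorem finrank_traceField_dvd_finrank_traceField_sup_fieldRange :
    finrank ℚ (traceField Φ) ∣ finrank ℚ (traceField Φ ⊔ φ₀.toRatAlgHom.fieldRange : IntermediateField ℚ ℂ) :=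
  finrank_dvd_of_le_de (traceField_le_traceField_sup_fieldRange Φ φ₀)

/-- `[E : ℚ] ≤ [E_Φ : ℚ] · [F : ℚ]` (degree of a compositum). [cite: MilneFT2022, Prop. 3.18 / Cor. 3.19 (`[EL : F] ≤ [E:F][L:F]`)] -/
theorem finrank_traceField_sup_fieldRange_le :
    finrank ℚ (traceField Φ ⊔ φ₀.toRatAlgHom.fieldRange : IntermediateField ℚ ℂ) ≤
      finrank ℚ (traceField Φ) * finrank ℚ F := by
  haveI := finiteDimensional_traceField_de Φ
  haveI := finiteDimensional_fieldRange_de φ₀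
  rw [← finrank_fieldRange_de φ₀]
  exact IntermediateField.finrank_sup_le _ _

/-- `2 ≤ [E : ℚ]` (`[K* : ℚ] ≥ 2`: a reflex field is never `ℚ`). [cite: Shimura1998, §8.3 Prop. 28 and §18.2] -/
theorem two_le_finrank_traceField_sup_fieldRange [IsCMField F] :
    2 ≤ finrank ℚ (traceField Φ ⊔ φ₀.toRatAlgHom.fieldRange : IntermediateField ℚ ℂ) := by
  haveI := finiteDimensional_sup_de Φ φ₀
  exact (two_le_finrank_traceField Φ).trans (finrank_le_of_le_de (traceField_le_traceField_sup_fieldRange Φ φ₀))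

variable {L : Type} [Field L] [NumberField L]

/-- **`E` lies in (the image of) every Galois `L/ℚ` through which `φ₀` factors**: if `φ₀ = ι ∘ j` with `j : F → L`,
`L/ℚ` Galois, `ι : L → ℂ`, then `E ⊆ ι(L)` (`K* ⊆ ι(L)` by Shimura's Prop. 28, `φ₀(F) = ι(j(F)) ⊆ ι(L)`); e.g. `L` a Galois
closure of `F`. [cite: Shimura1998, §8.3 Prop. 28] [cite: RapoportSmithlingZhang2017, §3.1 eq. (3.1)] -/
theorem traceField_sup_fieldRange_le_fieldRange [IsGalois ℚ L] (j : F →ₐ[ℚ] L) (ι : L →+* ℂ)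
    (h : ι.comp (j : F →+* L) = φ₀) :
    traceField Φ ⊔ φ₀.toRatAlgHom.fieldRange ≤ ι.toRatAlgHom.fieldRange := by
  refine sup_le (traceField_le_fieldRange j ι Φ) fun z hz => ?_
  obtain ⟨x, rfl⟩ := AlgHom.mem_fieldRange.1 hz
  refine AlgHom.mem_fieldRange.2 ⟨j x, ?_⟩
  change ι (j x) = φ₀ x
  rw [← h]
  rfl

/-- Hence `[E : ℚ] ∣ [L : ℚ]` for every such `L`. [cite: MilneFT2022, Prop. 1.20] [cite: Shimura1998, §8.3 Prop. 28] -/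
theorem finrank_traceField_sup_fieldRange_dvd [IsGalois ℚ L] (j : F →ₐ[ℚ] L) (ι : L →+* ℂ)
    (h : ι.comp (j : F →+* L) = φ₀) :
    finrank ℚ (traceField Φ ⊔ φ₀.toRatAlgHom.fieldRange : IntermediateField ℚ ℂ) ∣ finrank ℚ L := by
  rw [← finrank_fieldRange_de ι]
  exact finrank_dvd_of_le_de (traceField_sup_fieldRange_le_fieldRange Φ φ₀ j ι h)

end ReflexField

/-! ## §3 The Introduction's signature function `r` and «the composite of the reflex field of `r` and that of `Φ`» -/

section Signature

variable {Φ : CMType F} {φ₀ : F →+* ℂ} {n : ℕ} {r : (F →+* ℂ) → ℕ}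

/-- `conj ∘ conj = id` on complex embeddings. [folklore] -/
private theorem conjugate_conjugate_de (φ : F →+* ℂ) : ComplexEmbedding.conjugate (ComplexEmbedding.conjugate φ) = φ :=
  RingHom.ext fun x => by rw [ComplexEmbedding.conjugate_coe_eq, ComplexEmbedding.conjugate_coe_eq, Complex.conj_conj]

/-- An embedding outside `Φ` has its conjugate inside. [folklore] -/
private theorem conjugate_mem_of_not_mem_de {φ : F →+* ℂ} (hφ : φ ∉ Φ.1) : ComplexEmbedding.conjugate φ ∈ Φ.1 :=
  (Φ.2 _).2 (by rwa [conjugate_conjugate_de])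

/-- THE PRINTED CLAUSES OF `r` determine it: `r_{φ̄₀} = n − 1`. [cite: RapoportSmithlingZhang2017, Introduction p. 2 (definition of `r`)] -/
theorem apply_conjugate_eq_sub_one (hφ₀ : φ₀ ∈ Φ.1) (h₀ : r φ₀ = 1)
    (hc : ∀ φ : F →+* ℂ, φ ∉ Φ.1 → r φ = n - r (ComplexEmbedding.conjugate φ)) :
    r (ComplexEmbedding.conjugate φ₀) = n - 1 := by
  rw [hc _ ((Φ.2 φ₀).1 hφ₀), conjugate_conjugate_de, h₀]

/-- `r_φ = n` for `φ ∉ Φ`, `φ ≠ φ̄₀` (its conjugate lies in `Φ ∖ {φ₀}`). [cite: RapoportSmithlingZhang2017, Introduction p. 2 (definition of `r`)] -/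
theorem apply_eq_of_not_mem_of_ne_conjugate (hΦ : ∀ φ : F →+* ℂ, φ ∈ Φ.1 → φ ≠ φ₀ → r φ = 0)
    (hc : ∀ φ : F →+* ℂ, φ ∉ Φ.1 → r φ = n - r (ComplexEmbedding.conjugate φ))
    {φ : F →+* ℂ} (hφ : φ ∉ Φ.1) (hne : φ ≠ ComplexEmbedding.conjugate φ₀) : r φ = n := by
  have hne' : ComplexEmbedding.conjugate φ ≠ φ₀ := fun h => hne (by rw [← h, conjugate_conjugate_de])
  rw [hc φ hφ, hΦ _ (conjugate_mem_of_not_mem_de hφ) hne', Nat.sub_zero]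

/-- `r_φ ≤ 1` on `Φ` (`1` at `φ₀`, `0` elsewhere). [cite: RapoportSmithlingZhang2017, Introduction p. 2 (definition of `r`)] -/
theorem apply_le_one_of_mem (h₀ : r φ₀ = 1) (hΦ : ∀ φ : F →+* ℂ, φ ∈ Φ.1 → φ ≠ φ₀ → r φ = 0)
    {φ : F →+* ℂ} (hφ : φ ∈ Φ.1) : r φ ≤ 1 := by
  by_cases h : φ = φ₀
  · rw [h, h₀]
  · rw [hΦ φ hφ h]; exact Nat.zero_le _

/-- `n − 1 ≤ r_φ` off `Φ` (`r ∈ {n − 1, n}` there). [cite: RapoportSmithlingZhang2017, Introduction p. 2 (definition of `r`)] -/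
theorem sub_one_le_apply_of_not_mem (hΦ : ∀ φ : F →+* ℂ, φ ∈ Φ.1 → φ ≠ φ₀ → r φ = 0)
    (hc : ∀ φ : F →+* ℂ, φ ∉ Φ.1 → r φ = n - r (ComplexEmbedding.conjugate φ))
    (hφ₀ : φ₀ ∈ Φ.1) (h₀ : r φ₀ = 1) {φ : F →+* ℂ} (hφ : φ ∉ Φ.1) : n - 1 ≤ r φ := by
  by_cases hne : φ = ComplexEmbedding.conjugate φ₀
  · rw [hne, apply_conjugate_eq_sub_one hφ₀ h₀ hc]
  · rw [apply_eq_of_not_mem_of_ne_conjugate hΦ hc hφ hne]; exact Nat.sub_le n 1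

/-- **`r` is the signature of an `n`-dimensional hermitian space: `r_φ + r_φ̄ = n`** for every `φ` (`n ≥ 1`).
[cite: RapoportSmithlingZhang2017, Introduction p. 2 («signature `sig(W_φ) = (r_φ, r_φ̄)`»)] -/
theorem apply_add_apply_conjugate_eq (h₀ : r φ₀ = 1) (hΦ : ∀ φ : F →+* ℂ, φ ∈ Φ.1 → φ ≠ φ₀ → r φ = 0)
    (hc : ∀ φ : F →+* ℂ, φ ∉ Φ.1 → r φ = n - r (ComplexEmbedding.conjugate φ)) (hn : 1 ≤ n) (φ : F →+* ℂ) :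
    r φ + r (ComplexEmbedding.conjugate φ) = n := by
  by_cases hφ : φ ∈ Φ.1
  · have h1 := apply_le_one_of_mem h₀ hΦ hφ
    rw [hc _ ((Φ.2 φ).1 hφ), conjugate_conjugate_de]
    omega
  · have h1 := apply_le_one_of_mem h₀ hΦ (conjugate_mem_of_not_mem_de hφ)
    rw [hc _ hφ]
    omega

/-- **`Stab(r) ∩ Stab(Φ) ≤ Stab(φ₀)`**: if `τ` preserves `r` and `Φ` then `τφ₀ = φ₀` (`τφ₀` is the member of `Φ` at which
`r = 1`). [cite: RapoportSmithlingZhang2017, Introduction p. 2 («the composite of the reflex field of `r` and the reflex field of `Φ`»)]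
[cite: RapoportSmithlingZhang2017, §3.1 eq. (3.1)] -/
theorem smul_eq_of_forall_apply_smul_eq_of_forall_smul_mem_iff (hφ₀ : φ₀ ∈ Φ.1) (h₀ : r φ₀ = 1)
    (hΦ : ∀ φ : F →+* ℂ, φ ∈ Φ.1 → φ ≠ φ₀ → r φ = 0) {τ : ℂ ≃+* ℂ} (hr : ∀ φ : F →+* ℂ, r (τ • φ) = r φ)
    (hτ : ∀ χ : F →+* ℂ, τ • χ ∈ Φ.1 ↔ χ ∈ Φ.1) : τ • φ₀ = φ₀ := by
  by_contra hne
  have h := hΦ _ ((hτ φ₀).2 hφ₀) hne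
  rw [hr, h₀] at h
  exact one_ne_zero h

/-! ### `n ≥ 3`: `Φ = {r ≤ 1}` and `{φ₀} = {r = 1}`, so `Stab(r) ≤ Stab(Φ) ∩ Stab(φ₀)` -/

/-- For `n ≥ 3`, **`Φ = {φ ∣ r_φ ≤ 1}`** (`r ∈ {0, 1}` on `Φ`, `r ∈ {n−1, n}` off `Φ`). [cite: RapoportSmithlingZhang2017, Introduction p. 2] -/
theorem mem_iff_apply_le_one (hφ₀ : φ₀ ∈ Φ.1) (h₀ : r φ₀ = 1) (hΦ : ∀ φ : F →+* ℂ, φ ∈ Φ.1 → φ ≠ φ₀ → r φ = 0)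
    (hc : ∀ φ : F →+* ℂ, φ ∉ Φ.1 → r φ = n - r (ComplexEmbedding.conjugate φ)) (h3 : 3 ≤ n) (φ : F →+* ℂ) :
    φ ∈ Φ.1 ↔ r φ ≤ 1 := by
  refine ⟨fun hφ => apply_le_one_of_mem h₀ hΦ hφ, fun h => ?_⟩
  by_contra hφ
  have h2 := sub_one_le_apply_of_not_mem hΦ hc hφ₀ h₀ hφ
  omega

/-- For `n ≥ 3`, **`φ₀` is THE embedding with `r_φ = 1`**. [cite: RapoportSmithlingZhang2017, Introduction p. 2] -/
theorem apply_eq_one_iff (hφ₀ : φ₀ ∈ Φ.1) (h₀ : r φ₀ = 1) (hΦ : ∀ φ : F →+* ℂ, φ ∈ Φ.1 → φ ≠ φ₀ → r φ = 0)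
    (hc : ∀ φ : F →+* ℂ, φ ∉ Φ.1 → r φ = n - r (ComplexEmbedding.conjugate φ)) (h3 : 3 ≤ n) (φ : F →+* ℂ) :
    r φ = 1 ↔ φ = φ₀ := by
  refine ⟨fun h => ?_, fun h => by rw [h, h₀]⟩
  by_contra hne
  by_cases hφ : φ ∈ Φ.1
  · rw [hΦ φ hφ hne] at h
    exact zero_ne_one h
  · have h2 := sub_one_le_apply_of_not_mem hΦ hc hφ₀ h₀ hφ
    omega

/-- `n ≥ 3`: **`Stab(r) ≤ Stab(Φ)`** (`Φ` is a level set of `r`). [cite: RapoportSmithlingZhang2017, Introduction p. 2]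
[cite: RapoportSmithlingZhang2017, §3.1 eq. (3.1)] -/
theorem forall_smul_mem_iff_of_forall_apply_smul_eq (hφ₀ : φ₀ ∈ Φ.1) (h₀ : r φ₀ = 1)
    (hΦ : ∀ φ : F →+* ℂ, φ ∈ Φ.1 → φ ≠ φ₀ → r φ = 0)
    (hc : ∀ φ : F →+* ℂ, φ ∉ Φ.1 → r φ = n - r (ComplexEmbedding.conjugate φ)) (h3 : 3 ≤ n) {τ : ℂ ≃+* ℂ}
    (hr : ∀ φ : F →+* ℂ, r (τ • φ) = r φ) (χ : F →+* ℂ) : τ • χ ∈ Φ.1 ↔ χ ∈ Φ.1 := by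
  rw [mem_iff_apply_le_one hφ₀ h₀ hΦ hc h3, mem_iff_apply_le_one hφ₀ h₀ hΦ hc h3, hr]

/-- `n ≥ 3`: **`Stab(r) ≤ Stab(φ₀)`** (`{φ₀}` is a level set of `r`). [cite: RapoportSmithlingZhang2017, Introduction p. 2]
[cite: RapoportSmithlingZhang2017, §3.1 eq. (3.1)] -/
theorem smul_eq_of_forall_apply_smul_eq (hφ₀ : φ₀ ∈ Φ.1) (h₀ : r φ₀ = 1)
    (hΦ : ∀ φ : F →+* ℂ, φ ∈ Φ.1 → φ ≠ φ₀ → r φ = 0)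
    (hc : ∀ φ : F →+* ℂ, φ ∉ Φ.1 → r φ = n - r (ComplexEmbedding.conjugate φ)) (h3 : 3 ≤ n) {τ : ℂ ≃+* ℂ}
    (hr : ∀ φ : F →+* ℂ, r (τ • φ) = r φ) : τ • φ₀ = φ₀ :=
  (apply_eq_one_iff hφ₀ h₀ hΦ hc h3 (τ • φ₀)).1 (by rw [hr, h₀])

/-! ### `F` a CM field: `Stab(Φ) ∩ Stab(φ₀) ≤ Stab(r)`, the stabiliser identities and their field-level readings -/

section CM

variable [NumberField F] [IsCMField F]

/-- `τφ̄ = \overline{τφ}`: complex conjugation commutes with `Aut(ℂ)` on the embeddings of a CM field.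
[cite: Shimura1998, §18.2 Lemma (i)] -/
private theorem smul_conjugate_de (τ : ℂ ≃+* ℂ) (φ : F →+* ℂ) :
    τ • ComplexEmbedding.conjugate φ = ComplexEmbedding.conjugate (τ • φ) := by
  refine RingHom.ext fun x => ?_
  change τ (starRingEnd ℂ (φ x)) = starRingEnd ℂ (τ (φ x))
  rw [← IsCMField.complexEmbedding_complexConj F φ x]
  exact IsCMField.complexEmbedding_complexConj F ((τ : ℂ →+* ℂ).comp φ) x

/-- **`Stab(Φ) ∩ Stab(φ₀) ≤ Stab(r)`** (`F` a CM field, so that `τφ̄ = \overline{τφ}`): if `τΦ = Φ` and `τφ₀ = φ₀` then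
`r_{τφ} = r_φ` for every `φ`. [cite: RapoportSmithlingZhang2017, Introduction p. 2] [cite: RapoportSmithlingZhang2017, §3.1 eq. (3.1)] -/
theorem apply_smul_eq_of_forall_smul_mem_iff_of_smul_eq
    (hΦ : ∀ φ : F →+* ℂ, φ ∈ Φ.1 → φ ≠ φ₀ → r φ = 0)
    (hc : ∀ φ : F →+* ℂ, φ ∉ Φ.1 → r φ = n - r (ComplexEmbedding.conjugate φ)) {τ : ℂ ≃+* ℂ}
    (hτ : ∀ χ : F →+* ℂ, τ • χ ∈ Φ.1 ↔ χ ∈ Φ.1) (hτ₀ : τ • φ₀ = φ₀) (φ : F →+* ℂ) : r (τ • φ) = r φ := by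
  -- on `Φ`: `τ` fixes `φ₀` and permutes `Φ ∖ {φ₀}`, where `r = 0`
  have aux : ∀ ψ : F →+* ℂ, ψ ∈ Φ.1 → r (τ • ψ) = r ψ := fun ψ hψ => by
    by_cases h : ψ = φ₀
    · rw [h, hτ₀]
    · have hne : τ • ψ ≠ φ₀ := fun h' => h (smul_left_cancel τ (h'.trans hτ₀.symm))
      rw [hΦ _ ((hτ ψ).2 hψ) hne, hΦ ψ hψ h]
  by_cases hφ : φ ∈ Φ.1
  · exact aux φ hφ
  · have hτφ : τ • φ ∉ Φ.1 := fun h => hφ ((hτ φ).1 h)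
    rw [hc _ hτφ, hc _ hφ, ← smul_conjugate_de, aux _ (conjugate_mem_of_not_mem_de hφ)]

/-- **«`E` is the composite of the reflex field of `r` and the reflex field of `Φ`» = eq. (3.1), at the level of
stabilisers: `Stab(r) ∩ Stab(Φ) = Stab(Φ) ∩ Stab(φ₀)`** (any `n`; `F` CM). [cite: RapoportSmithlingZhang2017, Introduction p. 2]
[cite: RapoportSmithlingZhang2017, §3.1 eq. (3.1)] -/
theorem forall_apply_smul_eq_and_iff (hφ₀ : φ₀ ∈ Φ.1) (h₀ : r φ₀ = 1)
    (hΦ : ∀ φ : F →+* ℂ, φ ∈ Φ.1 → φ ≠ φ₀ → r φ = 0)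
    (hc : ∀ φ : F →+* ℂ, φ ∉ Φ.1 → r φ = n - r (ComplexEmbedding.conjugate φ)) (τ : ℂ ≃+* ℂ) :
    ((∀ φ : F →+* ℂ, r (τ • φ) = r φ) ∧ ∀ χ : F →+* ℂ, τ • χ ∈ Φ.1 ↔ χ ∈ Φ.1) ↔
      (∀ χ : F →+* ℂ, τ • χ ∈ Φ.1 ↔ χ ∈ Φ.1) ∧ τ • φ₀ = φ₀ :=
  ⟨fun h => ⟨h.2, smul_eq_of_forall_apply_smul_eq_of_forall_smul_mem_iff hφ₀ h₀ hΦ h.1 h.2⟩,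
    fun h => ⟨apply_smul_eq_of_forall_smul_mem_iff_of_smul_eq hΦ hc h.1 h.2, h.1⟩⟩

/-- Field level: **`E = E_Φ · φ₀(F)` is the fixed field of `Stab(r) ∩ Stab(Φ)`**, i.e. the composite `E_r · E_Φ` of the
Introduction. [cite: RapoportSmithlingZhang2017, Introduction p. 2] [cite: RapoportSmithlingZhang2017, §3.1 eq. (3.1)]
[cite: Lang2002, Ch. VIII §1] -/
theorem mem_traceField_sup_fieldRange_iff_forall_apply_smul_eq_forall_smul_mem_iff
    (hφ₀ : φ₀ ∈ Φ.1) (h₀ : r φ₀ = 1) (hΦ : ∀ φ : F →+* ℂ, φ ∈ Φ.1 → φ ≠ φ₀ → r φ = 0)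
    (hc : ∀ φ : F →+* ℂ, φ ∉ Φ.1 → r φ = n - r (ComplexEmbedding.conjugate φ)) (z : ℂ) :
    z ∈ traceField Φ ⊔ φ₀.toRatAlgHom.fieldRange ↔
      ∀ τ : ℂ ≃+* ℂ, (∀ φ : F →+* ℂ, r (τ • φ) = r φ) → (∀ χ : F →+* ℂ, τ • χ ∈ Φ.1 ↔ χ ∈ Φ.1) → τ z = z := by
  rw [mem_traceField_sup_fieldRange_iff_forall]
  refine ⟨fun h τ hr hτ => h τ hτ (smul_eq_of_forall_apply_smul_eq_of_forall_smul_mem_iff hφ₀ h₀ hΦ hr hτ),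
    fun h τ hτ hτ₀ => h τ (apply_smul_eq_of_forall_smul_mem_iff_of_smul_eq hΦ hc hτ hτ₀) hτ⟩

/-- **`n ≥ 3`: `Stab(r) = Stab(Φ) ∩ Stab(φ₀) = Aut(ℂ/E)`** — the reflex field of `r` alone is already `E` (`F` CM for `⟸`).
[cite: RapoportSmithlingZhang2017, Introduction p. 2] [cite: RapoportSmithlingZhang2017, §3.1 eq. (3.1)] -/
theorem forall_apply_smul_eq_iff (hφ₀ : φ₀ ∈ Φ.1) (h₀ : r φ₀ = 1)
    (hΦ : ∀ φ : F →+* ℂ, φ ∈ Φ.1 → φ ≠ φ₀ → r φ = 0)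
    (hc : ∀ φ : F →+* ℂ, φ ∉ Φ.1 → r φ = n - r (ComplexEmbedding.conjugate φ)) (h3 : 3 ≤ n) (τ : ℂ ≃+* ℂ) :
    (∀ φ : F →+* ℂ, r (τ • φ) = r φ) ↔ (∀ χ : F →+* ℂ, τ • χ ∈ Φ.1 ↔ χ ∈ Φ.1) ∧ τ • φ₀ = φ₀ :=
  ⟨fun hr => ⟨forall_smul_mem_iff_of_forall_apply_smul_eq hφ₀ h₀ hΦ hc h3 hr,
      smul_eq_of_forall_apply_smul_eq hφ₀ h₀ hΦ hc h3 hr⟩,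
    fun h => apply_smul_eq_of_forall_smul_mem_iff_of_smul_eq hΦ hc h.1 h.2⟩

/-- `n ≥ 3`: `τ` preserves `r` iff it fixes `E = E_Φ · φ₀(F)` pointwise. [cite: RapoportSmithlingZhang2017, Introduction p. 2]
[cite: RapoportSmithlingZhang2017, §3.1 eq. (3.1)] -/
theorem forall_apply_smul_eq_iff_forall_mem_traceField_sup_fieldRange (hφ₀ : φ₀ ∈ Φ.1) (h₀ : r φ₀ = 1)
    (hΦ : ∀ φ : F →+* ℂ, φ ∈ Φ.1 → φ ≠ φ₀ → r φ = 0)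
    (hc : ∀ φ : F →+* ℂ, φ ∉ Φ.1 → r φ = n - r (ComplexEmbedding.conjugate φ)) (h3 : 3 ≤ n) (τ : ℂ ≃+* ℂ) :
    (∀ φ : F →+* ℂ, r (τ • φ) = r φ) ↔ ∀ z : ℂ, z ∈ traceField Φ ⊔ φ₀.toRatAlgHom.fieldRange → τ z = z := by
  rw [forall_apply_smul_eq_iff hφ₀ h₀ hΦ hc h3, forall_mem_traceField_sup_fieldRange_iff]

/-- Field level, `n ≥ 3`: **`E = E_Φ · φ₀(F)` is the reflex field of `r`**, i.e. the fixed field of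
`Stab(r) = {τ ∣ r_{τφ} = r_φ ∀φ}`. [cite: RapoportSmithlingZhang2017, Introduction p. 2] [cite: RapoportSmithlingZhang2017, §3.1 eq. (3.1)]
[cite: Lang2002, Ch. VIII §1] -/
theorem mem_traceField_sup_fieldRange_iff_forall_apply_smul_eq (hφ₀ : φ₀ ∈ Φ.1) (h₀ : r φ₀ = 1)
    (hΦ : ∀ φ : F →+* ℂ, φ ∈ Φ.1 → φ ≠ φ₀ → r φ = 0)
    (hc : ∀ φ : F →+* ℂ, φ ∉ Φ.1 → r φ = n - r (ComplexEmbedding.conjugate φ)) (h3 : 3 ≤ n) (z : ℂ) :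
    z ∈ traceField Φ ⊔ φ₀.toRatAlgHom.fieldRange ↔ ∀ τ : ℂ ≃+* ℂ, (∀ φ : F →+* ℂ, r (τ • φ) = r φ) → τ z = z := by
  rw [mem_traceField_sup_fieldRange_iff_forall]
  refine ⟨fun h τ hr => h τ (forall_smul_mem_iff_of_forall_apply_smul_eq hφ₀ h₀ hΦ hc h3 hr)
      (smul_eq_of_forall_apply_smul_eq hφ₀ h₀ hΦ hc h3 hr),
    fun h τ hτ hτ₀ => h τ (apply_smul_eq_of_forall_smul_mem_iff_of_smul_eq hΦ hc hτ hτ₀)⟩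

end CM

end Signature

/-! ## §4 «possibly proper when `F/ℚ` is not Galois» -/

section Proper

variable [NumberField F] (Φ : CMType F) (φ₀ : F →+* ℂ)

/-- **`E = φ₀(F)` iff `E_Φ ⊆ φ₀(F)`.** [cite: RapoportSmithlingZhang2017, §3.1 (after eq. (3.1))] -/
theorem traceField_sup_fieldRange_eq_fieldRange_iff :
    traceField Φ ⊔ φ₀.toRatAlgHom.fieldRange = φ₀.toRatAlgHom.fieldRange ↔ traceField Φ ≤ φ₀.toRatAlgHom.fieldRange :=
  sup_eq_right

/-- **`E = φ₀(F)` iff `Stab(φ₀) ⊆ Stab(Φ)`**, i.e. iff every automorphism of `ℂ` fixing `φ₀` stabilises `Φ`.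
[cite: RapoportSmithlingZhang2017, §3.1 eq. (3.1)] [cite: Shimura1998, §8.3 Prop. 28] [cite: Lang2002, Ch. VIII §1] -/
theorem traceField_sup_fieldRange_eq_fieldRange_iff_forall :
    traceField Φ ⊔ φ₀.toRatAlgHom.fieldRange = φ₀.toRatAlgHom.fieldRange ↔
      ∀ τ : ℂ ≃+* ℂ, τ • φ₀ = φ₀ → ∀ χ : F →+* ℂ, τ • χ ∈ Φ.1 ↔ χ ∈ Φ.1 := by
  haveI := finiteDimensional_fieldRange_de φ₀
  rw [traceField_sup_fieldRange_eq_fieldRange_iff, traceField_le_iff_forall_smul_mem_iff_of_finiteDimensional]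
  refine forall_congr' fun τ => ?_
  rw [forall_mem_fieldRange_iff_smul_eq]

/-- **`F/ℚ` GALOIS ⟹ `E = φ₀(F)`** for every CM type `Φ` and every `φ₀` (`E_Φ ⊆ φ₀(F)` because the reflex field lies in
every Galois field through which the embeddings of `F` factor — here `F` itself): the case EXCLUDED by «possibly proper
when `F/ℚ` is not Galois». [cite: RapoportSmithlingZhang2017, §3.1 (after eq. (3.1))] [cite: Shimura1998, §8.3 Prop. 28] -/
theorem traceField_sup_fieldRange_eq_fieldRange_of_isGalois [IsGalois ℚ F] :
    traceField Φ ⊔ φ₀.toRatAlgHom.fieldRange = φ₀.toRatAlgHom.fieldRange :=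
  (traceField_sup_fieldRange_eq_fieldRange_iff Φ φ₀).2 (traceField_le_fieldRange (AlgHom.id ℚ F) φ₀ Φ)

/-- `F/ℚ` Galois ⟹ `E_Φ ⊆ φ₀(F)` for every `φ₀`. [cite: Shimura1998, §8.3 Prop. 28] -/
theorem traceField_le_fieldRange_of_isGalois [IsGalois ℚ F] : traceField Φ ≤ φ₀.toRatAlgHom.fieldRange :=
  traceField_le_fieldRange (AlgHom.id ℚ F) φ₀ Φ

/-- `F/ℚ` Galois ⟹ `[E : ℚ] = [F : ℚ]`. [cite: RapoportSmithlingZhang2017, §3.1 (after eq. (3.1))] -/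
theorem finrank_traceField_sup_fieldRange_of_isGalois [IsGalois ℚ F] :
    finrank ℚ (traceField Φ ⊔ φ₀.toRatAlgHom.fieldRange : IntermediateField ℚ ℂ) = finrank ℚ F := by
  rw [traceField_sup_fieldRange_eq_fieldRange_of_isGalois, finrank_fieldRange_de]

/-- `F/ℚ` Galois ⟹ `Stab(φ₀) ⊆ Stab(Φ)`: an automorphism of `ℂ` fixing `φ₀` stabilises every CM type of `F`.
[cite: Shimura1998, §8.3 Prop. 28] [cite: MilneFT2022, Cor. 3.10] -/
theorem forall_smul_mem_iff_of_smul_eq_of_isGalois [IsGalois ℚ F] {τ : ℂ ≃+* ℂ} (hτ : τ • φ₀ = φ₀) (χ : F →+* ℂ) :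
    τ • χ ∈ Φ.1 ↔ χ ∈ Φ.1 :=
  (traceField_sup_fieldRange_eq_fieldRange_iff_forall Φ φ₀).1 (traceField_sup_fieldRange_eq_fieldRange_of_isGalois Φ φ₀)
    τ hτ χ

/-- **`E = φ₀(F) ⟹ [E_Φ : ℚ] ∣ [F : ℚ]`.** [cite: RapoportSmithlingZhang2017, §3.1 (after eq. (3.1))] [cite: MilneFT2022, Prop. 1.20] -/
theorem finrank_traceField_dvd_of_traceField_sup_fieldRange_eq_fieldRange
    (h : traceField Φ ⊔ φ₀.toRatAlgHom.fieldRange = φ₀.toRatAlgHom.fieldRange) :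
    finrank ℚ (traceField Φ) ∣ finrank ℚ F := by
  rw [← finrank_fieldRange_de φ₀]
  exact finrank_dvd_of_le_de ((traceField_sup_fieldRange_eq_fieldRange_iff Φ φ₀).1 h)

/-- **«possibly proper»: if `[E_Φ : ℚ] ∤ [F : ℚ]` then `φ₀(F) ⊊ E` for EVERY `φ₀`.** [cite: RapoportSmithlingZhang2017, §3.1 (after eq. (3.1))]
[cite: MilneFT2022, Prop. 1.20] -/
theorem traceField_sup_fieldRange_ne_fieldRange_of_not_dvd (h : ¬ finrank ℚ (traceField Φ) ∣ finrank ℚ F) :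
    traceField Φ ⊔ φ₀.toRatAlgHom.fieldRange ≠ φ₀.toRatAlgHom.fieldRange :=
  fun he => h (finrank_traceField_dvd_of_traceField_sup_fieldRange_eq_fieldRange Φ φ₀ he)

/-- **«possibly proper»: if `[F : ℚ] < [E_Φ : ℚ]` then `φ₀(F) ⊊ E` for every `φ₀`** — e.g. whenever `[E_Φ : ℚ] = 2^g`
with `g = [F : ℚ]/2 ≥ 3` (Dodson's generic case, the tree's `finrank_traceField_eq_two_pow_of_finrank_normalClosure_eq`).
[cite: RapoportSmithlingZhang2017, §3.1 (after eq. (3.1))] [cite: Dodson1984, §1.3 (Reflex Degree Theorem)] -/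
theorem traceField_sup_fieldRange_ne_fieldRange_of_finrank_lt (h : finrank ℚ F < finrank ℚ (traceField Φ)) :
    traceField Φ ⊔ φ₀.toRatAlgHom.fieldRange ≠ φ₀.toRatAlgHom.fieldRange :=
  traceField_sup_fieldRange_ne_fieldRange_of_not_dvd Φ φ₀ fun hd =>
    (not_lt.2 (Nat.le_of_dvd Module.finrank_pos hd)) h

/-- In that case `[F : ℚ] < [E : ℚ]`. [cite: RapoportSmithlingZhang2017, §3.1 (after eq. (3.1))] [cite: MilneFT2022, Prop. 1.20] -/
theorem finrank_lt_finrank_traceField_sup_fieldRange_of_ne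
    (h : traceField Φ ⊔ φ₀.toRatAlgHom.fieldRange ≠ φ₀.toRatAlgHom.fieldRange) :
    finrank ℚ F < finrank ℚ (traceField Φ ⊔ φ₀.toRatAlgHom.fieldRange : IntermediateField ℚ ℂ) := by
  haveI := finiteDimensional_sup_de Φ φ₀
  refine lt_of_le_of_ne (finrank_le_finrank_traceField_sup_fieldRange Φ φ₀) fun he => h ?_
  rw [← finrank_fieldRange_de φ₀] at he
  exact (IntermediateField.eq_of_le_of_finrank_eq (fieldRange_le_traceField_sup_fieldRange Φ φ₀) he).symm

end Proper

end Literature.NumberTheory.ComplexMultiplication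

end
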